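import Mathlib
import HarnessLib
import HarnessLib.Audit
import Summits.SmoothPoincare4.Statement
import Literature.Topology.FourManifolds.Morse
import Literature.Topology.FourManifolds.ConnectedSum
import Literature.Topology.FourManifolds.Diffeotopy
import Literature.Topology.FourManifolds.HomotopyS4CompactProofs
import HarnessLib.Audit.Status.Attr

/-!
Route: CircularKirby

DORMANT since 2026-08-23T16:09:26Z (reconciler: no traction for 6.1 d (last activity item-evidence-added at 2026-08-17T12:55:13Z); parked, not closed — `ledger route dormant route-SmoothPoincare4-CircularKirby --off` to reactivate) — unstaffed, not closed; items shared with open routes are served there. `ledger route dormant <id> --off` reactivates.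

# Route CircularKirby — Circular Kirby calculus on the S¹×S³-stabilisation of Σ — the Morse–Novikov
ladder μ○ ≤ 4, with 3-manifold levels and Perelman as recogniser

It suffices to show X = RankTwo ∧ WidthFour, two statements about the class 𝒳 of closed smooth
4-manifolds X ≃ₕ S¹×S³ that
contain a smoothly embedded non-separating S³ (𝒳 is exactly {X_Σ := Σ # (S¹×S³) : Σ a homotopy
4-sphere}). Write μ○(X) for the
circular Morse (Morse–Novikov) number: the least number of critical points of a circle-valued Morse
function X → S¹ whose pullback of
ℝ → S¹ is connected (primitive class). WidthFour: every X ∈ 𝒳 has μ○(X) ≤ 4. RankTwo: X ∈ 𝒳 and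
μ○(X) ≤ 4 ⇒ μ○(X) = 0, i.e. X fibres
smoothly over S¹. Platform (theorems, filed as support): X ≃ₕ S¹×S³ fibred ⇒ X ≅ S¹×S³ (Ehresmann +
Perelman + Cerf), and
Σ # (S¹×S³) ≅ S¹×S³ ⇒ Σ ≅ S⁴ (Budney–Gabai 2019 Thm 3.13). Realises card
circular-kirby-calculus-rotation (moves, μ○, rungs) on the
platform of card s1s3-remembers-fibering-perelman ((R), FIB, recognisers). RankOne (μ○ ≤ 2 ⇒ fibred,
for every homotopy S¹×S³) is
the certified first rung and the template test; it is a crux outside the assembly.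
Lean: `RankTwo ∧ WidthFour`

## Assembly
Pure packaging once the items hold (deciding theorem `closes`, re-certified at rev 5). Fix a
Hausdorff, second countable smooth
4-manifold M with e : M ≃ₕ S⁴ — literally the binder of `SmoothPoincare4`; compactness of M is the
PROVED tree theorem
`compactSpace_of_homotopyEquiv_sphere_four_holds` used inside the proof, and since rev 5
(route-repair, cone) no orientation and no
`HomotopySphere` structure is needed, so the route file imports only Morse (mhessian), ConnectedSum
(IsConnectedSum), Diffeotopy
(IsDiffeotopic) and HomotopyS4CompactProofs, all sorry-free and fact-free. Platform gives P = M #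
(S¹×S³) with its instances,
eP : P ≃ₕ S¹×S³ and a non-separating S³; WidthFour gives a primitive circle-valued Morse function
with ≤ 4 critical points;
RankTwo turns it into a primitive submersion; FibredIsStandard (fed the route's OWN recogniser
items: the crux PoincareThreeSphere =
Perelman's theorem and the support CerfDiffSphereThree = Cerf's π₀ Diff⁺ S³ = 0, both stated inline
over Mathlib + Diffeotopy only)
gives P ≅ S¹×S³; Remembers (fed CerfDiffSphereThree and NonSepSphereTransitive) gives M ≅ S⁴.
RankOne is not used by the assembly
(first rung, template test). No item names an unproved Literature Prop and, since rev 5, no item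
names a constant whose FILE carries
one: the 3-dimensional Poincaré theorem is the ranked crux PoincareThreeSphere (definitionally the
tree fact
`nonempty_diffeomorph_sphere_three`), Cerf's theorem is the inline support item CerfDiffSphereThree
(equivalent to the tree fact
`cerf_pi0Diff_sphere_three` by `Diffeomorph.ext` + `coe_sphereReflection = rfl`, checked in the
planner's Bridge.lean), Budney–Gabai
3.13 is the inline support item NonSepSphereTransitive; all three close by one or two lines the day
a Literature `_holds` lands.
GENUINELY NEEDED tree facts (tier-0 debt of this line): needs-fact:
Literature.Topology.FourManifolds.nonempty_diffeomorph_sphere_three;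
needs-fact: Literature.Topology.FourManifolds.cerf_pi0Diff_sphere_three. Every other unproved fact
the priority census saw in the
rev-4 import cone rode in on an import the items do not use (HomotopySpheres ⇒ Θₙ-group / Smale /
Freedman h-cobordism facts;
RadialExtension ⇒ the rest of the Cerf cluster) — dropped at rev 5 — or on the operator-owned
`Statement.lean` import of SPC4Wave0
(13 sibling facts: Freedman, Schoenflies, exotic ℝ⁴, Milnor spheres …), which sits under every route
of this summit and which no
route edit can remove. The fibering recogniser needs Perelman intrinsically (the fibre of any
fibration of a homotopy S¹×S³ over
S¹ is only a homotopy 3-sphere), so there is no honest re-route around it.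

Rationale: WHY THIS LINE. A Kirby diagram of Σ is one circle-valued Morse function on X_Σ = Σ # (S¹×S³) (cut at
the level S³); circle-valued Cerf theory has one
extra move, ROTATION (push a critical point once around the circle), after which the reference level
is an arbitrary closed 3-manifold
Y and every question "does this 2/3 pair cancel" is a Dehn-surgery question about a framed knot and
a non-separating sphere in a
3-manifold level — the part of topology with the deepest rigidity theorems (Gabai1987,
Scharlemann1990, GompfScharlemannThompson2010
Prop 3.2, Laudenbach1973, McCullough1990) — while recognition of the end product is outsourced to
Perelman2002 (fibre ≃ S³ ⇒ S³) and
Cerf1968. Imported: circle-valued Morse / Morse–Novikov theory (Pajitnov2006, HutchingsLee1999,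
Farrell1971; dimension-4 precedent
EndoPajitnov2017 for 2-knot complements, where the same invariant MN is studied) and the 2019
transitivity theorem BudneyGabai2019
Thm 3.13 that makes S¹×S³-stabilisation lossless. Novikov homology of X_Σ vanishes identically (X̄_Σ
≃ S³, ℤ((t)) kills H₀), so
no algebraic lower bound exists and every rung is geometric. What no prior route does: NoOneHandles
/ GroupTrisection keep the level
S³ (interval-valued handle theory, AC-shadowed by PropertyTwoRBarrier); here levels move, μ○ ≤ μ − 2
strictly contains each closed
rung, and the k = 1 rung is a theorem-candidate whose proof passes through an arbitrary level Y.

RANKED CRUXES. #0 Target (target) — X = RankTwo ∧ WidthFour: on the class 𝒳, circular Morse number ≤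
4 forces a fibration over S¹, and every member of 𝒳 has circular Morse number ≤ 4. (why it might
fail: X ⟺ SPC4 given the platform theorems; it fails iff an exotic S⁴ exists — RankTwo fails iff one
has μ○ = 4, WidthFour iff one has μ○ ≥ 6.) [GompfScharlemannThompson2010, BudneyGabai2019,
Pajitnov2006, FreedmanGompfMorrisonWalker2010]
#2 RankTwo (crux) — (card RUNG 2) for every closed smooth X ≃ₕ S¹×S³ containing a smooth
non-separating S³: if X admits a circle-valued Morse function with connected pullback cover and at
most 4 critical points, then X admits a circle-valued submersion with connected pullback cover (X
fibres over S¹). Index patterns (c₁,c₂,c₃) ∈ {(0,2,2),(1,2,1),(2,2,0)} over an ARBITRARY base level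
Y; over Y = S³ the sector (0,2,2) contains 'X_L ≅ S⁴ for 2-component links L with surgery #²(S¹×S²)'
(weak Property 2R) and (1,2,1) contains the (3;1,1,1)-trisected homotopy spheres. [deps: RankOne]
[difficulty: open-problem] (why it might fail: Contains weak Property 2R for 2-component links (GST
§9, open) and (3;1,1,1)-trisection standardness (MSZ Conj. 3.11 frontier); the bet that rotating to
a non-S³ level simplifies attaching knots is untested; false iff an exotic S⁴ has μ○ = 4.)
[GompfScharlemannThompson2010, MeierSchirmerZupan2016, MeierZupan2017, Gompf1991Killing,
LidmanOliveiraSmithZupan2026, Pajitnov2006, arXiv:2604.17737]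
#3 RankOne (crux) — (card RUNG 1, stated for EVERY closed smooth homotopy S¹×S³, no cross-section
needed) if X ≃ₕ S¹×S³ admits a circle-valued Morse function with connected pullback cover and at
most 2 critical points, then X fibres over S¹. Route to it: indices are {2,3} (0/1 and 3/4 pairs
cancel, 0/3 and 1/4 are excluded by level component count); levels Y and Y_K ≅ Y # (S¹×S²) with the
3-handle on a non-separating sphere A; X̄ ≃ S³ forces the algebraic intersection d = A·K* ∈ {0, ±1}
(d ≥ 2 makes H₂(X̄₊,Y) an infinite torsion group inside the finitely generated H₁(X̄₋)); d = ±1 must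
be upgraded to geometric intersection 1 (then the pair cancels), d = 0 to disjointness (then rotate:
the base level loses an S¹×S² summand) — a double-coset problem Stab(A)\Diff(Y # S¹×S²)/Stab(core)
plus 'Y_K ≅ Y # S¹×S² ⇒ K is a local 0-framed unknot' (Y = S³: Property R; Y = S¹×S²: GST Prop 3.2).
[difficulty: L] (why it might fail: 'Y_K ≅ Y # S¹×S² ⇒ K local unknot' is in print only for Y = S³,
S¹×S² (Gabai; GST Prop 3.2); for Y with torsion-free-rank ≥ 2 the double coset
Stab(A)\Mod(Y#S¹×S²)/Stab(core) may hold d = ±1 classes of geometric intersection ≥ 3 closing up to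
a homotopy S¹×S³.) [GabaiJDG1987, GompfScharlemannThompson2010, Scharlemann1990, Laudenbach1973,
McCullough1990, OsborneZieschang1981, EndoPajitnov2017]
#4 WidthFour (crux) — (card 'μ○ ≤ 4 exhaustion', the compression half) every closed smooth X ≃ₕ
S¹×S³ containing a smooth non-separating S³ admits a circle-valued Morse function with connected
pullback cover and at most 4 critical points. Equivalently every homotopy 4-sphere Σ has μ○(Σ) ≤ 4;
implied by 'Σ has a handle decomposition with ≤ 2 two-handles' since a decomposition with (k, n,
n−k) 1-,2-,3-handles gives a circular function on X_Σ with 2n critical points (μ○ ≤ μ − 2).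
[difficulty: open-problem] (why it might fail: No compression technique reduces the 2-handle count
of an unknown Σ (1↔3 trading needs embedded discs, Kirby 4.18); rotation/ℤ((t))-slides may not reach
4 either; false iff an exotic S⁴ has μ○ ≥ 6 (e.g. a Gluck twist of a non-ribbon 2-knot needing 3
two-handles).) [Kirby1997, GompfStipsicz1999, Pajitnov2006, EndoPajitnov2017, AkbulutKirby1985]
#5 PoincareThreeSphere (crux) — (recogniser input; PROMOTED 2026-08-15 by route-choice from the
named-fact item PoincareThree: the cited Literature fact `nonempty_diffeomorph_sphere_three` is
XL-apex and non-crux facts may not be split, so the route carries Perelman's theorem as its own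
ranked obligation, stated inline and definitionally equal to the tree fact) every closed (compact,
Hausdorff, second countable), simply connected smooth 3-manifold is diffeomorphic to S³; first
antecedent of FibredIsStandard (the fibre of the Ehresmann fibration of a fibred homotopy S¹×S³ is a
homotopy 3-sphere ⇒ S³). Ranked last: a theorem whose risk is closure cost. [deps: FibredIsStandard,
Assembly] [difficulty: XL] (why it might fail: A THEOREM (Perelman; MorganTian2007 Thm 0.1 ⇒ Cor
0.2(a); statement = Mathlib proof_wanted, audited faithful) — the risk is closure, not truth: XL
debt, no Ricci flow / surgery (MT Thm 15.9) / finite extinction (Thm 18.1) in Mathlib; closes only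
via a Literature _holds or its one-layer split.) [Perelman2002Entropy, Perelman2003a, Perelman2003b,
MorganTian2007, Hamilton1982, arXiv:math/0211159, arXiv:math/0303109, arXiv:math/0307245]
#9 NonSepSphereTransitive (support) — KNOWN THEOREM (Budney–Gabai 2019, Thm 3.13, n = 3; cite item
filed — grounder: promote to a Literature named fact, provers do not formalise from scratch):
Diff(S¹×S³) acts transitively on smoothly embedded non-separating 3-spheres, i.e. every smooth
embedding e : S³ → S¹×S³ with connected complement of its image is carried by a self-diffeomorphism
onto {1}×S³. It is the hypothesis of Remembers and of the Assembly. [difficulty: XL]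
[BudneyGabai2019, arXiv:1912.09029]
#9 FibredIsStandard (support) — (card 'μ○ = 0 ⟺ standard'; recogniser of the sibling card) given
Perelman and Cerf — both spelled out INLINE as antecedents, verbatim the bodies of the items
PoincareThreeSphere and CerfDiffSphereThree (rev 5: Cerf in the reflection-free phrasing below) —: a
closed smooth X ≃ₕ S¹×S³ admitting a circle-valued submersion with connected pullback cover is
diffeomorphic to S¹×S³. Proof: Ehresmann ⇒ bundle with closed connected fibre F; homotopy sequence
with π₁X = ℤ →≅ π₁S¹ ⇒ π₁F = 1 ⇒ F ≅ S³ (Perelman) ⇒ X is the mapping torus of φ ∈ Diff(S³); φ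
diffeotopic to id or a reflection (Cerf); the reflection torus has H₃ = ℤ/2 ≠ ℤ = H₃(S¹×S³),
excluded by the homotopy equivalence; id gives S¹×S³. [difficulty: L] [Perelman2002, MorganTian2007,
CerfDiffeoSphere1968, Farrell1971, Milnor1965]
#9 Remembers (support) — (sibling card (R): S¹×S³ remembers) given Cerf (inline text of
CerfDiffSphereThree; Γ₄ = 0 for the capping step follows from it in tree by the PROVED reduction
`cerf_twistedSphere_four_of_pi0`) and Budney–Gabai 3.13 (inline text of NonSepSphereTransitive): for
every Hausdorff second-countable compact smooth 4-manifold M ≃ₕ S⁴ and every connected sum P of M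
with S¹×S³, P ≅ S¹×S³ ⇒ M ≅ S⁴. RESTATED rev 5 (route-repair, cone): quantified over a plain `M ≃ₕ
S⁴` instead of `S : HomotopySphere 4` (the structure's file HomotopySpheres.lean carries the
unproved Θₙ-group / h-cobordism facts into the import cone); equivalent to the rev-4 item modulo the
PROVED `isOrientable_of_homotopyEquiv_sphere_four_holds` (Bridge.lean, lean rc 0). Proof: A = {θ}×S³
away from the summing ball is a non-separating S³ in P; transport it by P ≅ S¹×S³ and straighten it
to {1}×S³ by transitivity, so P cut along A ≅ I×S³; but P cut along A = (M∖B°) ∪ ((I×S³)∖B'°); cap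
both boundary spheres with balls (Palais disc theorem + Γ₄ = 0, tree BallGluingUniqueness /
CerfGammaFour) ⇒ M ≅ S⁴. [difficulty: L (XL in Lean)] [BudneyGabai2019, KervaireMilnor1963,
Cerf1968]
#9 Platform (support) — (sibling card, platform) for every Hausdorff second-countable compact smooth
4-manifold M ≃ₕ S⁴ there is a closed smooth 4-manifold P which is a connected sum M # (S¹×S³) (tree
ConnectedSumExistence), is homotopy equivalent to S¹×S³ (M° is a homotopy 4-ball glued to (S¹×S³)°),
and contains a smooth non-separating S³ (a fibre {θ}×S³ missing the summing point). RESTATED rev 5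
over a plain `M ≃ₕ S⁴` (was `S : HomotopySphere 4`; equivalent modulo the proved orientability
theorem, Bridge.lean). [difficulty: L] [KervaireMilnor1963, Kosinski1993, BudneyGabai2019]
#9 CerfDiffSphereThree (support) — Cerf 1968, Ch. I §1, Théorème 1 (π₀ Diff⁺ S³ = 0) in the tree's
orientation-free phrasing: every self-diffeomorphism of S³ is diffeotopic to the identity or to a
hyperplane reflection; second antecedent of FibredIsStandard (monodromy of the S³-bundle) and first
of Remembers (Γ₄ = 0). RESTATED rev 5 (route-repair, cone) REFLECTION-FREE: 'for every unit vector v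
and every diffeomorphism ρ of S³ that is pointwise the Householder reflection y ↦ y − 2⟨y,v⟩v
(Mathlib `(ℝ ∙ v)ᗮ.reflection`), every φ ∈ Diff(S³) is diffeotopic to id or to ρ' — so that the item
names only Mathlib and `Diffeotopy.IsDiffeotopic(ToId)` (fact-free file) instead of
`sphereReflection` (ClosedBallProofs ⇒ ClosedBall ⇒ Cobordism, which carries Freedman's TOP
h-cobordism fact into the cone); EQUIVALENT to
`Literature.Topology.FourManifolds.cerf_pi0Diff_sphere_three` (ρ = sphereReflection v by
`Diffeomorph.ext`, `coe_sphereReflection` is rfl; both directions checked in Bridge.lean, lean rc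
0), hence closes by two lines when a `_holds` lands: needs-fact:
Literature.Topology.FourManifolds.cerf_pi0Diff_sphere_three (in tree already reduced to the single
leaf `cerf_pi0DiffDisc_relBoundary_three`, CerfPropositionFour.lean). KNOWN THEOREM (reproved by
Hatcher 1983); provers do NOT formalise Cerf's monograph from scratch; kept SUPPORT. [difficulty:
XL] [CerfDiffeoSphere1968, Hatcher1983]
#9 FibredIsStandard / Assembly — restated 2026-08-15 with the two recogniser antecedents spelled out
inline (FibredIsStandard) resp. by item name (Assembly: PoincareThreeSphere → CerfDiffSphereThree →
NonSepSphereTransitive → RankTwo → WidthFour → FibredIsStandard → Remembers → Platform →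
SmoothPoincare4); meaning unchanged. The alias item PoincareThree (:= the Literature constant) is
dropped — an item whose body is the cited constant keeps the dependency cone dirty, which is exactly
why rev 2 was unstaffable. Rev 5 (route-repair cone, 2026-08-15): FibredIsStandard's Cerf antecedent
follows the reflection-free text of CerfDiffSphereThree (equivalent, Bridge.lean); Assembly text
unchanged; the route-level imports shrink from {HomotopySpheres, Morse, ConnectedSum,
RadialExtension, HomotopyS4CompactProofs, HomotopyS4OrientableProofs} to {Morse, ConnectedSum,
Diffeotopy, HomotopyS4CompactProofs} — the only unproved facts left in the file-level cone are the
13 SPC4Wave0 siblings imported by the operator-owned Statement.lean itself, of which exactly one is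
used: needs-fact: Literature.Topology.FourManifolds.nonempty_diffeomorph_sphere_three (= crux
PoincareThreeSphere).

TWO-LAYER PLAN. Foreseen glued splits (none filed now; k ≤ 3, depth 1). RankOne ⇐ GprY → AlgToGeom →
RankOne, where GprY: 'K ⊂ Y closed oriented,
Y_K ≅ Y # (S¹×S²) ⇒ K is a 0-framed unknot in a ball' (Gabai/Scharlemann/GST Prop 3.2 pattern,
induction on the prime decomposition)
and AlgToGeom: 'in Y # (S¹×S²), a knot in the Diff-orbit of the core with algebraic intersection ±1
(resp. 0) with the belt sphere is
isotopic to one meeting it once (resp. not at all)', plus the homological input d ∈ {0,±1}. RankTwo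
⇐ RankTwo022 → RankTwo121 →
RankTwo (the (2,2,0) sector is (0,2,2) for f⁻¹; a circular-thin-position lemma FIN — 'μ○ ≤ 4 is
attained with all levels of
Heegaard genus ≤ 4' — is the intended first child if a level-genus notion becomes typable).
WidthFour ⇐ TwoTwoHandles →
HandlesToCircular → WidthFour, where TwoTwoHandles: 'every homotopy 4-sphere has a Morse function
with ≤ 2 index-2 critical points'
(typable now over `IsMorse`/`criticalSetOfIndex`) and HandlesToCircular: 'a Morse function on Σ with
n index-2 points yields a
primitive circle-valued Morse function on Σ # (S¹×S³) with 2n critical points' (provable-now, L).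
PoincareThreeSphere ⇐ SurgeryFlow → FiniteExtinction → PoincareThreeSphere (k = 2,
Morgan–Tian's own architecture, verified on the held text pp. 8, 12–13, 403, 461–462): SurgeryFlow =
MT Thm 0.3 (= Thm 15.9 + Cor 15.4: for a
closed Riemannian 3-manifold without locally separating ℝP² a Ricci flow with surgery exists for all
t ≥ 0, surgery times are discrete, and
crossing one is a connected-sum decomposition plus removal of components ≅ S²×S¹, ℝP³#ℝP³, S²×̃S¹ or
spherical space forms); FiniteExtinction =
MT Thm 0.4 (= Thm 18.1: if π₁ is a free product of finite and infinite cyclic groups the flow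
becomes extinct in finite time); the glue is
MT's one-paragraph deduction of Thm 0.1 (downward induction along M = M₀, …, M_k = ∅) specialised to
π₁ = 1. Both children are XL; the
split exists so that apex verdicts are recorded per component, and is filed only by a lineage's
final-cycle reduction proposal.

KILL CRITERIA. RankTwo or WidthFour REFUTED (inside 𝒳) is an exotic S⁴: close `refuted:<Decl>`, hand
the witness (a homotopy S¹×S³ with μ○ = 4 or
an X_Σ with μ○ ≥ 6) to the negative side — it settles the summit negatively. RankOne refuted by a
homotopy S¹×S³ WITHOUT S³
cross-section (an exotic S¹×S³ with μ○ = 2) does not touch SPC4: pivot by `--restate RankOne` to the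
class 𝒳. Soft kills: (i) a
refuter shows every level of a μ○ ≤ 4 function on an X ∈ 𝒳 is S³ or #ᵏ(S¹×S²) after rotation-free
reordering, i.e. RankTwo ≡ weak
Property 2R ∧ (3;1,1,1)-standardness with rotation adding nothing → close `superseded` in favour of
NoOneHandles/GroupTrisection;
(ii) RankOne stalls with a documented double-coset obstruction for some Y (census) → route dormant
until AlgToGeom is understood.
SPC4 proved elsewhere moots the route; NoOneHandles.C2 proved elsewhere closes the (0,2,2) sector
only. PoincareThreeSphere and
CerfDiffSphereThree are theorems (Perelman; Cerf, Hatcher) and cannot be refuted; a lineage that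
cannot close PoincareThreeSphere ends with
the foreseen split or the verdict xl-apex, leaving the route `closed modulo ⟨PoincareThreeSphere⟩`
at best — the honest ceiling of every
fibering recogniser, accepted at promotion (2026-08-15); it is not a reason to close the route while
RankOne/RankTwo/WidthFour are live.

NOT DECOMPOSED YET. Deliberately not filed at open: the index-pattern sectors of RankTwo
((0,2,2)/(1,2,1)/(2,2,0)) and the base-level regimes (Y = S³,
Y = #ᵏ(S¹×S²), general Y) of RankOne — they are the foreseen glued splits of the TWO-LAYER PLAN and
are filed only after a first rung closes or
when a lineage's final cycle asks for them; likewise the one layer under PoincareThreeSphere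
(SurgeryFlow / FiniteExtinction) is filed only by a
lineage's final-cycle reduction proposal, never pre-emptively, and Ricci flow is never formalised
from scratch inside this route's Theorems.

CHEAPEST FALSIFIER. Two lookups and one computation, in this order. (1) LOOKUP: is RankOne
contradicted or already known? — Pajitnov2006 (Ch. on Morse maps
M → S¹ with 2 critical points), EndoPajitnov2017 §5 (2-knots K with MN(K) = 2: surgery X_K is a
homotopy S¹×S³ with μ○ ≤ 2 when
π₁ = ℤ; group-ℤ 2-knots are TOP-unknotted, no smooth counterexample known), fake/homotopy S¹×S³
literature (Akbulut1991Fake needs an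
S²×S² summand; no closed exotic S¹×S³ is known). Expected: neither killed nor known — I could not
run it fully (remote APIs 429 all
session; Pajitnov2006 not held: want filed). (2) LOOKUP: does BudneyGabai2019 Thm 3.13 (read: p. 22,
verbatim) carry parametrised or
only setwise transitivity? Setwise suffices for Remembers (checked). (3) COMPUTATION (kit/GAP,
cheap): breadth-first AC-search on the
free-stabilised Akbulut–Kirby presentations ⟨x,y,t | xyx = yxy, x⁴ = y³⟩ (circular AC = ordinary AC
after adding the relator-free
generator t): a trivialisation at small length would exhibit rotation doing something Kirby calculus
over S³ is conjectured not to do;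
a negative search kills nothing.

NUMBERS. χ(X_Σ) = 0, so c₁ − c₂ + c₃ = 0 and (after eliminating index 0/4, Pajitnov–Rudolph–Weber
Lemma 3.2 as used in EndoPajitnov2017
Prop. 1.3) μ○ is even; μ○(Σ) ≤ μ(Σ) − 2 = 2·(number of 2-handles). Rung 0: μ○ = 0 ⟺ Σ ≅ S⁴ (Perelman
+ Cerf + BG 3.13). Rung 1
(μ○ = 2): indices {2,3}; d = A·K* ∈ {0, ±1}. Rung 2 (μ○ = 4): patterns (0,2,2), (1,2,1), (2,2,0).
Known at base level S³: one
2-handle, no 1-handles ⇒ S⁴ (Property R, GabaiJDG1987 Cor. 8.3); trisection genus ≤ 2 ⇒ standard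
(MeierZupan2017; barrier
LowGenusTrisectionBarrier), first open type (3;1,1,1); GST links L_n: X_{L_n} ≅ S⁴
(Gompf1991Killing) but slide-triviality open and
AC-shadowed for n ≥ 3 (GompfScharlemannThompson2010 §7–8; AK(n) AC-trivial for n ≤ 2). Novikov
numbers of X_Σ: b̂ᵢ = q̂ᵢ = 0 for
all i (no lower bound). EndoPajitnov2017: MN(S(K)) ≤ 2·MN(K) for spun knots, = 4 for nontrivial K of
tunnel number 1. Items at open: 9
(1 target, 3 cruxes, 4 support, 1 assembly); after rev 3 (route-choice 2026-08-15): 11 (1 target, 4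
cruxes, 5 support, 1 assembly); rev 5 restates 4 support items 1:1 (same names, same count).
File-level import cone: rev 4 = 43 project modules with 20 unproved named facts in 6 files; rev 5 =
Statement ∪ 4 clean imports, 13 unproved facts, all in SPC4Wave0 via Statement.lean (operator), 1 of
them used.

DEFINITION REQUESTS. (a) `IsCircleMorse` / `circleMorseNumber` in Literature/Topology/FourManifolds
(Morse.lean generalised to maps into `Circle`: smooth,
critical set `{x | mfderiv I (𝓡 1) f x = 0}`, nondegenerate Hessian of the local height `y ↦ Im(f y
/ f x)`, primitive class =
connected pullback of `Circle.exp`); the items inline this today and should be restated over the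
notion when it lands. (b) SUPERSEDED 2026-08-15 by the
staffability rule (a cited Literature Prop without `_holds` in an item's cone makes the route
unstaffable): Budney–Gabai 2019 Thm 3.13
(arXiv:1912.09029 p. 22) stays the inline support item NonSepSphereTransitive, exactly as Perelman /
Cerf are now the inline items
PoincareThreeSphere / CerfDiffSphereThree; a Literature statement of BG 3.13 is still welcome, but
the items keep their inline text until a
`_holds` exists, and then close by one line. (b′) rev 5: the same discipline now extends to FILES —
an item may not name a constant whose defining file (or its import closure) carries an unproved
named fact; hence `HomotopySphere` and `sphereReflection` are spelled out (plain `M ≃ₕ S⁴`;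
Householder formula). (c) later: 'Heegaard genus of a regular level' for FIN. WANT: Pajitnov2006 (de
Gruyter Studies 32) for
the index-0/4 elimination and 2-critical-point chapters.

Novelty: Searches (2026-08-15): `lit search --hybrid "circle-valued Morse function 4-manifold minimal number
of critical points Morse-Novikov
number"` (15 book rows, none on 4-manifolds); `lit search --source zbmath "Morse-Novikov number"`
(20: Pajitnov AGT 2010, Weber–
Pajitnov–Rudolph 2002, Goda 2006/2007, EndoPajitnov2017 = arXiv:1502.06352, Endo–Pajitnov
arXiv:1605.04532, Baker 2021, Chen–Endo–
Pajitnov arXiv:2606.24009); `lit vsearch` ×2 (fibering homotopy S¹×S³; circular handle cancellation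
— Freedman–Quinn, Kirby1989,
Juhasz2023, Hog-Angeloni–Metzler only); `lit galaxy search --star all "Morse-Novikov number"` (2
rows, noise), `"non-separating
3-sphere"` (0), `"circle-valued Morse"` (queue saturated ×2); `lit frontier SmoothPoincare4 --since
2020` (30: LidmanOliveiraSmithZupan2026
= arXiv:2603.05664, arXiv:2604.17737 GST-link experiments, arXiv:2603.23717 Dunfield–Gong sphere
standard, arXiv:2604.15087 cites BG);
`lit bridges --cross any` (noise); openalex/s2/arxiv APIs HTTP 429 all session; read BudneyGabai2019
p. 22 (Thm 3.12/3.13),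
GompfScharlemannThompson2010 p. 6 (Prop 3.1–3.3), EndoPajitnov2017 pp. 2–4, LOSZ pp. 1–2; refuter
audits of both cards.
Nearest prior art found: EndoPajitnov2017 (arXiv:1502.06352) — the Morse–Novikov number of a 2-knot
complement C_K → S¹ in dimension 4
(index-0/4 elimination, Novikov bounds, MN(S(K)) ≤ 2MN(K)); Pajitnov2006 / HutchingsLee1999
(circle-valued Morse–Cerf theory, MN);
BudneyGabai2019 Thm 3.13 (platform); GompfScharlemannThompson2010  [refs: 1502.06352, 1605.04532, 2606.24009, 2603.05664, 2604.17737, 2603.23717, 2604.15087, EndoPajitnov2017, Kirby1989, Juhasz2023, LidmanOliveiraSmithZupan2026, BudneyGabai2019, GompfScharlemannThompson2010, Pajitnov2006, HutchingsLee1999]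

Barriers (technique_class: circle-valued Morse theory; handle calculus; Dehn surgery): - technique_class: circle-valued Morse theory; handle calculus; Dehn surgery
- Literature.Barriers.SmoothPoincare4.PropertyTwoRBarrier: conditional (AKPresentationsACNontrivial)
obstruction to slide-only proofs over the level S³; RankTwo asks for a fibration/diffeomorphism, not
slide-triviality (GST Prop 9.2: the weak conjecture is untouched by the AC invariant), and rotation
enlarges the presentation calculus to AC on the free stabilisation ⟨xᵢ, t | rⱼ⟩ — whether AK(n) ∪
{t} is AC-trivial is the kit diagnostic; if it is not, slide+rotation proofs of the (0,2,2) sector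
over S³ inherit the barrier and the bet is other base levels.
- Literature.Barriers.SmoothPoincare4.StrictPropertyTwoRBarrier: same content for genuine slides;
same answer — no Property 2R statement (strict or permissive) is filed or implied by any item.
- Literature.Barriers.SmoothPoincare4.LowGenusTrisectionBarrier: marks the solved range g ≤ 2; the
(1,2,1) sector of RankTwo contains the first open type (3;1,1,1); the route re-parametrises it by a
movable base level and does not claim to pass it for free.
- Literature.Barriers.SmoothPoincare4.CappellShanesonFamilyBarrier: CS/AK spheres are known
standard; they enter only as test inputs ((2,2,0) pattern, μ○ ≤ 4) for the rotation diagnostic,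
never as candidates.
- Literature.Barriers.SmoothPoincare4.TwistedSphereBarrierFour: used positively (Cerf: capping Σ°°
and π₀Diff⁺(S³) = 0 in FibredIsStandard), not fought.
- Literature.Barriers.SmoothPoincare4.HCobordismB

Novelty grade: new-combination — ROUTE REVIEW (refuter-rreview 0d548a29; full memo = evidence file on stmt-7777). VERDICT: keep OPEN. Target 7777, RankOne 6424, NonSepSphereTransitive 6426, Platform 6429 elaborate verbatim (my W3.lean rc0). Assembly 6430 concludes SmoothPoincare4 itself (D-0027-conform, logic checked) but has two L (refuter refuter-rreview-route-CriticalPhenomena--0d548a29-0, 2026-08-15T14:00:38Z; prior: EndoPajitnov2017 (arXiv:1502.06352), BudneyGabai2019 (arXiv:1912.09029) Thm 3.13, GompfScharlemannThompson2010 Prop 3.2, GabaiJDG1987 (Property R), Pajitnov2010 AGT (arXiv:0811.2254), EndoPajitnov arXiv:1605.04532, ChenEndoPajitnov arXiv:2606.24009, Perelman2002 / CerfDiffeoSphere1968 (recognisers))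

History (route lifecycle, newest last):
- 2026-08-15T12:18:21Z · rev 1: restated Target (stmt-SmoothPoincare4-6422), Remembers (stmt-SmoothPoincare4-6428) — materialisation safety: Target := RankTwo ∧ WidthFour and Remembers := NonSepSphereTransitive → … referenced decls that the gate writes AFTER them (target first (planner-plancard-SmoothPoincare4-SmoothPoinca-e34a5793-0)
- 2026-08-15T16:40:32Z · rev 3: restated FibredIsStandard (stmt-SmoothPoincare4-6427), CerfDiffSphereThree (stmt-SmoothPoincare4-9599), Assembly (stmt-SmoothPoincare4-6430) — route-choice (unit rchoice-SmoothPoincare4-CircularKirby--9e1a3ef1): PROMOTE `nonempty_diffeomorph_sphere_three` (XL-apex) to the ranked crux PoincareThreeSpher (planner-rchoice-SmoothPoincare4-CircularKirby--9e1a3ef1-0)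
- 2026-08-15T16:40:32Z · rev 3: dropped stmt-SmoothPoincare4-9588 — route-choice (unit rchoice-SmoothPoincare4-CircularKirby--9e1a3ef1): PROMOTE `nonempty_diffeomorph_sphere_three` (XL-apex) to the ranked crux PoincareThreeSpher (planner-rchoice-SmoothPoincare4-CircularKirby--9e1a3ef1-0)
- 2026-08-15T16:52:31Z · rev 3: dropped stmt-SmoothPoincare4-9588 — route-choice repair pass (same unit): the 16:40:32Z combined edit was HALF-APPLIED by the gate during a farm outage (answered 'farm unavailable, nothing recorde (planner-rchoice-SmoothPoincare4-CircularKirby--9e1a3ef1-0)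
- 2026-08-15T17:02:22Z · rev 4: restated Remembers (stmt-SmoothPoincare4-7778) — route-repair (cone, Phase C; unit rrepair-SmoothPoincare4-CircularKirby-973ca3bb). (1) CONE: verified clean after the concurrent route-choice rev 3 (rchoice-…-9 (planner-rrepair-SmoothPoincare4-CircularKirby-973ca3bb-0)
- 2026-08-15T17:25:54Z · rev 5: restated CerfDiffSphereThree (stmt-SmoothPoincare4-11116), FibredIsStandard (stmt-SmoothPoincare4-11115), Remembers (stmt-SmoothPoincare4-11322), Platform (stmt-SmoothPoincare4-6429) — route-repair (cone, Phase C gen 2; unit rrepair-SmoothPoincare4-CircularKirby-973ca3bb-g2). The gate's constant-level cone was a (planner-rrepair-SmoothPoincare4-CircularKirby-973ca3bb-g2-0)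
- 2026-08-16T04:17:57Z · AUTO-CRUX (backfill): Target — hypotheses of the deciding theorem that nothing in the route derives are cruxes (operator:999:1085951)
- 2026-08-23T16:09:26Z · DORMANT — reconciler: no traction for 6.1 d (last activity item-evidence-added at 2026-08-17T12:55:13Z); parked, not closed — `ledger route dormant route-SmoothPoincare4- (operator:999:1147331)

sub-problem: SmoothPoincare4 · status: dormant · opened planner-plancard-SmoothPoincare4-SmoothPoinca-e34a5793-0 2026-08-15T11:46:31Z · rev 5 · ledger route-SmoothPoincare4-CircularKirby
GENERATED by the gate from the ledger (D-0016/17). Provers cite these decls: `theorem foo : Summit.SmoothPoincare4.SmoothPoincare4.Theses.CircularKirby.<Decl> := …` in Summits/SmoothPoincare4/SmoothPoincare4/Theorems/<Name>.lean.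
-/

namespace Summit.SmoothPoincare4.SmoothPoincare4.Theses.CircularKirby

open scoped BigOperators Topology Manifold Classical MeasureTheory ProbabilityTheory Matrix InnerProductSpace ComplexConjugate ContinuousMap ContDiff
open Filter Set Function TopologicalSpace MeasureTheory

attribute [summit_statement] _root_.SmoothPoincare4

open Literature.SPC4

-- earlier Target (stmt-SmoothPoincare4-6422, replaced 2026-08-15T12:18:21Z -> stmt-SmoothPoincare4-7777): retired by None — RankTwo ∧ WidthFour
/-- item stmt-SmoothPoincare4-7777 · crux (kind.auto-crux: conjecture-grade) · rank 0 · open · by planner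
why it might fail: X ⟺ SPC4 given the platform theorems; it fails iff an exotic S⁴ exists — RankTwo fails iff one has μ○ = 4, WidthFour iff one has μ○ ≥ 6.
sources: GompfScharlemannThompson2010, BudneyGabai2019, Pajitnov2006, FreedmanGompfMorrisonWalker2010
[target] X = RankTwo ∧ WidthFour: on the class 𝒳, circular Morse number ≤ 4 forces a fibration over
S¹, and every member of 𝒳 has circular Morse number ≤ 4. -/
@[route_item "route-SmoothPoincare4-CircularKirby", crux]
def Target : Prop :=
  (∀ (X : Type) [TopologicalSpace X] [T2Space X] [SecondCountableTopology X] [CompactSpace X] [ChartedSpace (EuclideanSpace ℝ (Fin 4)) X] [IsManifold (𝓡 4) ∞ X], X ≃ₕ (Circle × (Metric.sphere (0 : EuclideanSpace ℝ (Fin 4)) 1)) → (∃ e : (Metric.sphere (0 : EuclideanSpace ℝ (Fin 4)) 1) → X, Manifold.IsSmoothEmbedding (𝓡 3) (𝓡 4) ∞ e ∧ IsConnected (Set.range e)ᶜ) → (∃ f : X → Circle, ContMDiff (𝓡 4) (𝓡 1) ∞ f ∧ IsConnected {p : X × ℝ | f p.1 = Circle.exp p.2} ∧ (∀ x, mfderiv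 (𝓡 4) (𝓡 1) f x = 0 → (Literature.Topology.FourManifolds.mhessian (𝓡 4) (fun y => ((f y / f x : Circle) : ℂ).im) x).Nondegenerate) ∧ {x | mfderiv (𝓡 4) (𝓡 1) f x = 0}.encard ≤ 4) → ∃ g : X → Circle, ContMDiff (𝓡 4) (𝓡 1) ∞ g ∧ IsConnected {p : X × ℝ | g p.1 = Circle.exp p.2} ∧ ∀ x, mfderiv (𝓡 4) (𝓡 1) g x ≠ 0) ∧ (∀ (X : Type) [TopologicalSpace X] [T2Space X] [SecondCountableTopology X] [CompactSpace X] [ChartedSpace (EuclideanSpace ℝ (Fin 4)) X] [IsManifold (𝓡 4) ∞ X], X ≃ₕ (Circle × (Metric.sphere (0 : EuclideanSpace ℝ (Fin 4)) 1)) → (∃ e : (Metric.sphere (0 : EuclideanSpace ℝ (Fin 4)) 1) → X, Manifold.IsSmoothEmbedding (𝓡 3) (𝓡 4) ∞ e ∧ IsConnected (Set.range e)ᶜ) → ∃ f : X → Circle, ContMDiff (𝓡 4) (𝓡 1) ∞ f ∧ IsConnected {p : X × ℝ | f p.1 = Circle.exp p.2} ∧ (∀ x, mfderiv (𝓡 4)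 (𝓡 1) f x = 0 → (Literature.Topology.FourManifolds.mhessian (𝓡 4) (fun y => ((f y / f x : Circle) : ℂ).im) x).Nondegenerate) ∧ {x | mfderiv (𝓡 4) (𝓡 1) f x = 0}.encard ≤ 4)

/-- item stmt-SmoothPoincare4-6423 · crux · rank 2 · open · by planner
why it might fail: Contains weak Property 2R for 2-component links (GST §9, open) and (3;1,1,1)-trisection standardness (MSZ Conj. 3.11 frontier); the bet that rotating to a non-S³ level simplifies attaching knots is untested; false iff an exotic S⁴ has μ○ = 4.
sources: GompfScharlemannThompson2010, MeierSchirmerZupan2016, MeierZupan2017, Gompf1991Killing, LidmanOliveiraSmithZupan2026, Pajitnov2006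
[crux] (card RUNG 2) for every closed smooth X ≃ₕ S¹×S³ containing a smooth non-separating S³: if X
admits a circle-valued Morse function with connected pullback cover and at most 4 critical points,
then X admits a circle-valued submersion with connected pullback cover (X fibres over S¹). Index
patterns (c₁,c₂,c₃) ∈ {(0,2,2),(1,2,1),(2,2,0)} over an ARBITRARY base level Y; over Y = S³ the
sector (0,2,2) contains 'X_L ≅ S⁴ for 2-component links L with surgery #²(S¹×S²)' (weak Property 2R)
and (1,2,1) contains the (3;1,1,1)-trisected homotopy spheres. [deps: RankOne] [difficulty:
open-problem] -/
@[route_item "route-SmoothPoincare4-CircularKirby", crux]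
def RankTwo : Prop :=
  ∀ (X : Type) [TopologicalSpace X] [T2Space X] [SecondCountableTopology X] [CompactSpace X] [ChartedSpace (EuclideanSpace ℝ (Fin 4)) X] [IsManifold (𝓡 4) ∞ X], X ≃ₕ (Circle × (Metric.sphere (0 : EuclideanSpace ℝ (Fin 4)) 1)) → (∃ e : (Metric.sphere (0 : EuclideanSpace ℝ (Fin 4)) 1) → X, Manifold.IsSmoothEmbedding (𝓡 3) (𝓡 4) ∞ e ∧ IsConnected (Set.range e)ᶜ) → (∃ f : X → Circle, ContMDiff (𝓡 4) (𝓡 1) ∞ f ∧ IsConnected {p : X × ℝ | f p.1 = Circle.exp p.2} ∧ (∀ x, mfderiv (𝓡 4) (𝓡 1) f x = 0 → (Literature.Topology.FourManifolds.mhessian (𝓡 4) (fun y => ((f y / f x : Circle) : ℂ).im) x).Nondegenerate) ∧ {x | mfderiv (𝓡 4) (𝓡 1) f x = 0}.encard ≤ 4) → ∃ g : X → Circle, ContMDiff (𝓡 4) (𝓡 1) ∞ g ∧ IsConnected {p : X × ℝ | g p.1 = Circle.exp p.2} ∧ ∀ x, mfderiv (𝓡 4) (𝓡 1) g x ≠ 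0

/-- item stmt-SmoothPoincare4-6424 · crux · rank 3 · open · by planner
why it might fail: 'Y_K ≅ Y # S¹×S² ⇒ K local unknot' is in print only for Y = S³, S¹×S² (Gabai; GST Prop 3.2); for Y with torsion-free-rank ≥ 2 the double coset Stab(A)\Mod(Y#S¹×S²)/Stab(core) may hold d = ±1 classes of geometric intersection ≥ 3 closing up to a homotopy S¹×S³.
sources: GabaiJDG1987, GompfScharlemannThompson2010, Scharlemann1990, Laudenbach1973, McCullough1990, OsborneZieschang1981
[crux] (card RUNG 1, stated for EVERY closed smooth homotopy S¹×S³, no cross-section needed) if X ≃ₕ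
S¹×S³ admits a circle-valued Morse function with connected pullback cover and at most 2 critical
points, then X fibres over S¹. Route to it: indices are {2,3} (0/1 and 3/4 pairs cancel, 0/3 and 1/4
are excluded by level component count); levels Y and Y_K ≅ Y # (S¹×S²) with the 3-handle on a
non-separating sphere A; X̄ ≃ S³ forces the algebraic intersection d = A·K* ∈ {0, ±1} (d ≥ 2 makes
H₂(X̄₊,Y) an infinite torsion group inside the finitely generated H₁(X̄₋)); d = ±1 must be upgraded
to geometric intersection 1 (then the pair cancels), d = 0 to disjointness (then rotate: the base
level loses an S¹×S² summand) — a double-coset problem Stab(A)\Diff(Y # S¹×S²)/Stab(core) plus 'Y_K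
≅ Y # S¹×S² ⇒ K is a local 0-framed unknot' (Y = S³: Property R; Y = S¹×S²: GST Prop 3.2).
[difficulty: L] -/
@[route_item "route-SmoothPoincare4-CircularKirby", crux]
def RankOne : Prop :=
  ∀ (X : Type) [TopologicalSpace X] [T2Space X] [SecondCountableTopology X] [CompactSpace X] [ChartedSpace (EuclideanSpace ℝ (Fin 4)) X] [IsManifold (𝓡 4) ∞ X], X ≃ₕ (Circle × (Metric.sphere (0 : EuclideanSpace ℝ (Fin 4)) 1)) → (∃ f : X → Circle, ContMDiff (𝓡 4) (𝓡 1) ∞ f ∧ IsConnected {p : X × ℝ | f p.1 = Circle.exp p.2} ∧ (∀ x, mfderiv (𝓡 4) (𝓡 1) f x = 0 → (Literature.Topology.FourManifolds.mhessian (𝓡 4) (fun y => ((f y / f x : Circle) : ℂ).im) x).Nondegenerate) ∧ {x | mfderiv (𝓡 4) (𝓡 1) f x = 0}.encard ≤ 2) → ∃ g : X → Circle, ContMDiff (𝓡 4) (𝓡 1) ∞ g ∧ IsConnected {p : X × ℝ | g p.1 = Circle.exp p.2} ∧ ∀ x, mfderiv (𝓡 4) (𝓡 1) g x ≠ 0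

/-- item stmt-SmoothPoincare4-6425 · crux · rank 4 · open · by planner
why it might fail: No compression technique reduces the 2-handle count of an unknown Σ (1↔3 trading needs embedded discs, Kirby 4.18); rotation/ℤ((t))-slides may not reach 4 either; false iff an exotic S⁴ has μ○ ≥ 6 (e.g. a Gluck twist of a non-ribbon 2-knot needing 3 two-handles).
sources: Kirby1997, GompfStipsicz1999, Pajitnov2006, EndoPajitnov2017, AkbulutKirby1985
[crux] (card 'μ○ ≤ 4 exhaustion', the compression half) every closed smooth X ≃ₕ S¹×S³ containing a
smooth non-separating S³ admits a circle-valued Morse function with connected pullback cover and at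
most 4 critical points. Equivalently every homotopy 4-sphere Σ has μ○(Σ) ≤ 4; implied by 'Σ has a
handle decomposition with ≤ 2 two-handles' since a decomposition with (k, n, n−k) 1-,2-,3-handles
gives a circular function on X_Σ with 2n critical points (μ○ ≤ μ − 2). [difficulty: open-problem] -/
@[route_item "route-SmoothPoincare4-CircularKirby", crux]
def WidthFour : Prop :=
  ∀ (X : Type) [TopologicalSpace X] [T2Space X] [SecondCountableTopology X] [CompactSpace X] [ChartedSpace (EuclideanSpace ℝ (Fin 4)) X] [IsManifold (𝓡 4) ∞ X], X ≃ₕ (Circle × (Metric.sphere (0 : EuclideanSpace ℝ (Fin 4)) 1)) → (∃ e : (Metric.sphere (0 : EuclideanSpace ℝ (Fin 4)) 1) → X, Manifold.IsSmoothEmbedding (𝓡 3) (𝓡 4) ∞ e ∧ IsConnected (Set.range e)ᶜ) → ∃ f : X → Circle, ContMDiff (𝓡 4) (𝓡 1) ∞ f ∧ IsConnected {p : X × ℝ | f p.1 = Circle.exp p.2} ∧ (∀ x, mfderiv (𝓡 4) (𝓡 1) f x = 0 → (Literature.Topology.FourManifolds.mhessian (𝓡 4) (fun y => ((f y / f x :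 Circle) : ℂ).im) x).Nondegenerate) ∧ {x | mfderiv (𝓡 4) (𝓡 1) f x = 0}.encard ≤ 4

/-- item stmt-SmoothPoincare4-10767 · crux · rank 5 · open · by planner
why it might fail: A THEOREM (Perelman; MorganTian2007 Thm 0.1 ⇒ Cor 0.2(a); statement = Mathlib proof_wanted, audited faithful) — the risk is closure, not truth: XL debt, no Ricci flow / surgery (MT Thm 15.9) / finite extinction (Thm 18.1) in Mathlib; closes only via a Literature _holds or its one-layer split.
sources: Perelman2002Entropy, Perelman2003a, Perelman2003b, MorganTian2007, Hamilton1982, arXiv:math/0211159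
[support] APEX INPUT (a published theorem restated verbatim as a route hypothesis, inlined rather
than imported per the cone discipline of this route; NOT a prover target — it closes by one line
`theorem … : PoincareThreeSphere := nonempty_diffeomorph_sphere_three_holds` the day the Literature
named fact `Literature.Topology.FourManifolds.nonempty_diffeomorph_sphere_three` (SPC4Wave0,
spc4.S31) is discharged; it is definitionally that fact at universe 0, checked by `Iff.rfl` in the
planner's Sketch.lean). Perelman 2002–03 / Morgan–Tian 2007 Cor. 0.2 (a): a closed, simply connected
smooth 3-manifold is diffeomorphic to S³. This is the first antecedent already inlined in
FibrationRecognition and Assembly; filing it as an item lets the deciding theorem `closes` name it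
(D-0027 §2.1: hypotheses ⊆ items). Sources: Perelman2002, Perelman2003a, MorganTian2007. -/
@[route_item "route-SmoothPoincare4-CircularKirby", crux]
def PoincareThreeSphere : Prop :=
  ∀ (F : Type) [TopologicalSpace F] [T2Space F] [SecondCountableTopology F] [ChartedSpace (EuclideanSpace ℝ (Fin 3)) F] [IsManifold (𝓡 3) ∞ F] [SimplyConnectedSpace F] [CompactSpace F], Nonempty (F ≃ₘ⟮𝓡 3, 𝓡 3⟯ (Metric.sphere (0 : EuclideanSpace ℝ (Fin 4)) 1))

-- earlier CerfDiffSphereThree (stmt-SmoothPoincare4-11116, replaced 2026-08-15T17:25:54Z -> stmt-SmoothPoincare4-11356): retired by None — ∀ (v : (Metric.sphere (0 : EuclideanSpace ℝ (Fin 4)) 1)) (φ : (Metric.sphere (0 : EuclideanSpace ℝ (Fin 4)) 1) ≃ₘ⟮𝓡 3, 𝓡 3⟯ (Metric.sphere (0 : EuclideanSpace ℝ (Fin 4)) 1)), Literature.Topology.FourManifolds.Diffeomorph.IsDiffeotopicToId φ ∨ Literature.Topology.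
-- earlier CerfDiffSphereThree (stmt-SmoothPoincare4-9599, replaced 2026-08-15T16:40:32Z -> stmt-SmoothPoincare4-11057): retired by None — Literature.Topology.FourManifolds.cerf_pi0Diff_sphere_three
/-- item stmt-SmoothPoincare4-11356 · support · rank 9 · open · by planner
sources: CerfDiffeoSphere1968, Hatcher1983
[support] Cerf 1968, Ch. I §1, Théorème 1 (π₀ Diff⁺ S³ = 0) in the tree's orientation-free phrasing
— every self-diffeomorphism of S³ is diffeotopic to the identity or to a hyperplane reflection —
second antecedent of FibredIsStandard (monodromy of the S³-bundle X → S¹) and first antecedent of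
Remembers (Γ₄ = 0 for capping, via the PROVED tree reduction `cerf_twistedSphere_four_of_pi0Diff`).
RESTATED 2026-08-15 rev 5 (route-repair, cone) REFLECTION-FREE: for every unit vector v and every
self-diffeomorphism ρ of S³ that is pointwise the Householder reflection y ↦ y − 2⟨y,v⟩v (Mathlib
`(ℝ ∙ v)ᗮ.reflection`), every φ ∈ Diff(S³) is diffeotopic to id or to ρ. The item now names only
Mathlib and the fact-free file Diffeotopy.lean (`Diffeomorph.IsDiffeotopicToId/IsDiffeotopic`)
instead of `sphereReflection` (ClosedBallProofs ⇒ ClosedBall ⇒ Cobordism, whose unproved Freedman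
h-cobordism fact it dragged into the cone). EQUIVALENT to
`Literature.Topology.FourManifolds.cerf_pi0Diff_sphere_three` (ρ = sphereReflection v by
`Diffeomorph.ext` + `coe_sphereReflection` = rfl; both directions machine-checked in the planner's
Bridge.lean, lean rc 0): closes by two lines the day `cerf_pi0Diff_sphere -/
@[route_item "route-SmoothPoincare4-CircularKirby", crux]
def CerfDiffSphereThree : Prop :=
  ∀ (v : (Metric.sphere (0 : EuclideanSpace ℝ (Fin 4)) 1)) (ρ : (Metric.sphere (0 : EuclideanSpace ℝ (Fin 4)) 1) ≃ₘ⟮𝓡 3, 𝓡 3⟯ (Metric.sphere (0 : EuclideanSpace ℝ (Fin 4)) 1)), (∀ y : (Metric.sphere (0 : EuclideanSpace ℝ (Fin 4)) 1), ((ρ y : (Metric.sphere (0 : EuclideanSpace ℝ (Fin 4)) 1)) : EuclideanSpace ℝ (Fin 4)) = (ℝ ∙ (v : EuclideanSpace ℝ (Fin 4)))ᗮ.reflection (y : EuclideanSpace ℝ (Fin 4))) → ∀ (φ : (Metric.sphere (0 : EuclideanSpace ℝ (Fin 4)) 1) ≃ₘ⟮𝓡 3, 𝓡 3⟯ (Metric.sphere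 (0 : EuclideanSpace ℝ (Fin 4)) 1)), Literature.Topology.FourManifolds.Diffeomorph.IsDiffeotopicToId φ ∨ Literature.Topology.FourManifolds.Diffeomorph.IsDiffeotopic ρ φ

-- earlier FibredIsStandard (stmt-SmoothPoincare4-11115, replaced 2026-08-15T17:25:54Z -> stmt-SmoothPoincare4-11357): retired by None — (∀ (M : Type) [TopologicalSpace M] [T2Space M] [SecondCountableTopology M] [ChartedSpace (EuclideanSpace ℝ (Fin 3)) M] [IsManifold (𝓡 3) ∞ M] [SimplyConnectedSpace M] [CompactSpace M], Nonempty (M ≃ₘ⟮𝓡 3, 𝓡 3⟯ (Metric.sphere (0 : EuclideanSpace ℝ (Fin 4)) 1))) → (∀ 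
-- earlier FibredIsStandard (stmt-SmoothPoincare4-6427, replaced 2026-08-15T16:40:32Z -> stmt-SmoothPoincare4-11056): retired by None — Literature.Topology.FourManifolds.nonempty_diffeomorph_sphere_three.{0} → Literature.Topology.FourManifolds.cerf_pi0Diff_sphere_three → ∀ (X : Type) [TopologicalSpace X] [T2Space X] [SecondCountableTopology X] [CompactSpace X] [ChartedSpace (EuclideanSpace ℝ (Fin 4))
/-- item stmt-SmoothPoincare4-11357 · support · rank 9 · open · by planner
sources: Perelman2002, MorganTian2007, CerfDiffeoSphere1968, Farrell1971, Milnor1965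
[support] (card 'μ○ = 0 ⟺ standard'; fibering recogniser) given Perelman's theorem and Cerf's π₀
Diff⁺ S³ = 0 — both spelled out INLINE as antecedents, verbatim the bodies of the items
PoincareThreeSphere and CerfDiffSphereThree (rev 5: the Cerf antecedent in the reflection-free
phrasing, equivalent to the rev-4 text, Bridge.lean) —: a closed smooth X ≃ₕ S¹×S³ admitting a
circle-valued submersion with connected pullback cover is diffeomorphic to S¹×S³. Proof: Ehresmann ⇒
bundle over S¹ with closed connected fibre F; homotopy sequence with π₁X = ℤ →≅ π₁S¹ ⇒ π₁F = 1 ⇒ F ≅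
S³ (Perelman) ⇒ X is the mapping torus of φ ∈ Diff(S³); φ diffeotopic to id or to the reflection ρ
(Cerf); the reflection torus has H₃ = ℤ/2 ≠ ℤ = H₃(S¹×S³) (or: is non-orientable), excluded by the
homotopy equivalence; id gives S¹×S³. [difficulty: L (refuter 2026-08-15: XL in Lean — Ehresmann,
mapping tori)] Sources: Perelman2002, MorganTian2007, CerfDiffeoSphere1968, Farrell1971, Milnor1965. -/
@[route_item "route-SmoothPoincare4-CircularKirby", crux]
def FibredIsStandard : Prop :=
  (∀ (M : Type) [TopologicalSpace M] [T2Space M] [SecondCountableTopology M] [ChartedSpace (EuclideanSpace ℝ (Fin 3)) M] [IsManifold (𝓡 3) ∞ M] [SimplyConnectedSpace M] [CompactSpace M], Nonempty (M ≃ₘ⟮𝓡 3, 𝓡 3⟯ (Metric.sphere (0 : EuclideanSpace ℝ (Fin 4)) 1))) → (∀ (v : (Metric.sphere (0 : EuclideanSpace ℝ (Fin 4)) 1)) (ρ : (Metric.sphere (0 : EuclideanSpace ℝ (Fin 4)) 1) ≃ₘ⟮𝓡 3, 𝓡 3⟯ (Metric.sphere (0 : EuclideanSpace ℝ (Fin 4))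 1)), (∀ y : (Metric.sphere (0 : EuclideanSpace ℝ (Fin 4)) 1), ((ρ y : (Metric.sphere (0 : EuclideanSpace ℝ (Fin 4)) 1)) : EuclideanSpace ℝ (Fin 4)) = (ℝ ∙ (v : EuclideanSpace ℝ (Fin 4)))ᗮ.reflection (y : EuclideanSpace ℝ (Fin 4))) → ∀ (φ : (Metric.sphere (0 : EuclideanSpace ℝ (Fin 4)) 1) ≃ₘ⟮𝓡 3, 𝓡 3⟯ (Metric.sphere (0 : EuclideanSpace ℝ (Fin 4)) 1)), Literature.Topology.FourManifolds.Diffeomorph.IsDiffeotopicToId φ ∨ Literature.Topology.FourManifolds.Diffeomorph.IsDiffeotopic ρ φ) → ∀ (X : Type) [TopologicalSpace X] [T2Space X] [SecondCountableTopology X] [CompactSpace X] [ChartedSpace (EuclideanSpace ℝ (Fin 4)) X] [IsManifold (𝓡 4) ∞ X], X ≃ₕ (Circle × (Metric.sphere (0 : EuclideanSpace ℝ (Fin 4)) 1)) → (∃ g : X → Circle, ContMDiff (𝓡 4) (𝓡 1) ∞ g ∧ IsConnected {p : X × ℝ | g p.1 = Circle.exp p.2} ∧ ∀ x, mfderiv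 (𝓡 4) (𝓡 1) g x ≠ 0) → Nonempty (X ≃ₘ⟮𝓡 4, (𝓡 1).prod (𝓡 3)⟯ (Circle × (Metric.sphere (0 : EuclideanSpace ℝ (Fin 4)) 1)))

-- earlier Remembers (stmt-SmoothPoincare4-11322, replaced 2026-08-15T17:25:54Z -> stmt-SmoothPoincare4-11358): retired by None — (∀ (v : (Metric.sphere (0 : EuclideanSpace ℝ (Fin 4)) 1)) (φ : (Metric.sphere (0 : EuclideanSpace ℝ (Fin 4)) 1) ≃ₘ⟮𝓡 3, 𝓡 3⟯ (Metric.sphere (0 : EuclideanSpace ℝ (Fin 4)) 1)), Literature.Topology.FourManifolds.Diffeomorph.IsDiffeotopicToId φ ∨ Literature.Topology.FourManif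
-- earlier Remembers (stmt-SmoothPoincare4-6428, replaced 2026-08-15T12:18:21Z -> stmt-SmoothPoincare4-7778): retired by None — NonSepSphereTransitive → ∀ (S : Literature.Topology.FourManifolds.HomotopySphere 4) (P : Type) [TopologicalSpace P] [ChartedSpace (EuclideanSpace ℝ (Fin 4)) P] [IsManifold (𝓡 4) ∞ P], Literature.Topology.FourManifolds.IsConnectedSum (𝓡 4) (𝓡 4) ((𝓡 1).prod (𝓡 3)) S.carrier (
-- earlier Remembers (stmt-SmoothPoincare4-7778, replaced 2026-08-15T17:02:22Z -> stmt-SmoothPoincare4-11322): retired by None — (∀ e : (Metric.sphere (0 : EuclideanSpace ℝ (Fin 4)) 1) → Circle × (Metric.sphere (0 : EuclideanSpace ℝ (Fin 4)) 1), Manifold.IsSmoothEmbedding (𝓡 3) ((𝓡 1).prod (𝓡 3)) ∞ e → IsConnected (Set.range e)ᶜ → ∃ Φ : (Circle × (Metric.sphere (0 : EuclideanSpace ℝ (Fin 4)) 1)) ≃ₘ⟮(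
/-- item stmt-SmoothPoincare4-11358 · support · rank 9 · open · by planner
sources: BudneyGabai2019, KervaireMilnor1963, Cerf1968
[support] (sibling card (R): S¹×S³ remembers) given Cerf (the inline text of CerfDiffSphereThree)
and Budney–Gabai 2019 Thm 3.13 (the inline text of NonSepSphereTransitive): for every Hausdorff,
second countable, compact smooth 4-manifold M ≃ₕ S⁴ and every smooth 4-manifold P that is a
connected sum of M with S¹×S³, P ≅ S¹×S³ ⇒ M ≅ S⁴. RESTATED 2026-08-15 rev 5 (route-repair, cone):
quantified over a plain `M ≃ₕ S⁴` — literally the binder of the Statement plus compactness — instead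
of `S : HomotopySphere 4`, whose defining file HomotopySpheres.lean (⇒ Cobordism.lean) carries the
unproved Θₙ-group / Smale / Freedman h-cobordism facts into the import cone although no item uses
them; EQUIVALENT to the rev-4 item modulo the PROVED tree theorem
`isOrientable_of_homotopyEquiv_sphere_four_holds` (Bridge.lean, lean rc 0). Proof: A = {θ}×S³ away
from the summing ball is a non-separating S³ in P; transport it by P ≅ S¹×S³ and straighten it to
{1}×S³ by transitivity, so (P, A) ≅ (S¹×S³, {1}×S³) as pairs and P cut along A ≅ I×S³; but P cut
along A = (M∖B°) ∪_φ ((I×S³)∖B'°); cap both boundary spheres with balls: left side (M∖B°) ∪ D⁴ ≅ M,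
right side a twisted sphere ≅ S⁴; both identifications u -/
@[route_item "route-SmoothPoincare4-CircularKirby", crux]
def Remembers : Prop :=
  (∀ (v : (Metric.sphere (0 : EuclideanSpace ℝ (Fin 4)) 1)) (ρ : (Metric.sphere (0 : EuclideanSpace ℝ (Fin 4)) 1) ≃ₘ⟮𝓡 3, 𝓡 3⟯ (Metric.sphere (0 : EuclideanSpace ℝ (Fin 4)) 1)), (∀ y : (Metric.sphere (0 : EuclideanSpace ℝ (Fin 4)) 1), ((ρ y : (Metric.sphere (0 : EuclideanSpace ℝ (Fin 4)) 1)) : EuclideanSpace ℝ (Fin 4)) = (ℝ ∙ (v : EuclideanSpace ℝ (Fin 4)))ᗮ.reflection (y : EuclideanSpace ℝ (Fin 4))) → ∀ (φ : (Metric.sphere (0 : EuclideanSpace ℝ (Fin 4)) 1) ≃ₘ⟮𝓡 3, 𝓡 3⟯ (Metric.sphere (0 : EuclideanSpace ℝ (Fin 4)) 1)), Literature.Topology.FourManifolds.Diffeomorph.IsDiffeotopicToId φ ∨ Literature.Topology.FourManifolds.Diffeomorph.IsDiffeotopic ρ φ) → (∀ e : (Metric.sphere (0 : EuclideanSpace ℝ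 (Fin 4)) 1) → Circle × (Metric.sphere (0 : EuclideanSpace ℝ (Fin 4)) 1), Manifold.IsSmoothEmbedding (𝓡 3) ((𝓡 1).prod (𝓡 3)) ∞ e → IsConnected (Set.range e)ᶜ → ∃ Φ : (Circle × (Metric.sphere (0 : EuclideanSpace ℝ (Fin 4)) 1)) ≃ₘ⟮(𝓡 1).prod (𝓡 3), (𝓡 1).prod (𝓡 3)⟯ (Circle × (Metric.sphere (0 : EuclideanSpace ℝ (Fin 4)) 1)), Φ '' (Set.range e) = Set.range (fun p : (Metric.sphere (0 : EuclideanSpace ℝ (Fin 4)) 1) => ((1 : Circle), p))) → ∀ (M : Type) [TopologicalSpace M] [T2Space M] [SecondCountableTopology M] [CompactSpace M] [ChartedSpace (EuclideanSpace ℝ (Fin 4)) M] [IsManifold (𝓡 4) ∞ M], M ≃ₕ (Metric.sphere (0 : EuclideanSpace ℝ (Fin 5)) 1) → ∀ (P : Type) [TopologicalSpace P] [ChartedSpace (EuclideanSpace ℝ (Fin 4)) P] [IsManifold (𝓡 4) ∞ P], Literature.Topology.FourManifolds.IsConnectedSum (𝓡 4) (𝓡 4) ((𝓡 1).prod (𝓡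 3)) M (Circle × (Metric.sphere (0 : EuclideanSpace ℝ (Fin 4)) 1)) P → Nonempty (P ≃ₘ⟮𝓡 4, (𝓡 1).prod (𝓡 3)⟯ (Circle × (Metric.sphere (0 : EuclideanSpace ℝ (Fin 4)) 1))) → Nonempty (M ≃ₘ⟮𝓡 4, 𝓡 4⟯ (Metric.sphere (0 : EuclideanSpace ℝ (Fin 5)) 1))

-- earlier Platform (stmt-SmoothPoincare4-6429, replaced 2026-08-15T17:25:54Z -> stmt-SmoothPoincare4-11359): retired by None — ∀ S : Literature.Topology.FourManifolds.HomotopySphere 4, ∃ (P : Type) (_ : TopologicalSpace P) (_ : T2Space P) (_ : SecondCountableTopology P) (_ : CompactSpace P) (_ : ChartedSpace (EuclideanSpace ℝ (Fin 4)) P) (_ : IsManifold (𝓡 4) ∞ P), Literature.Topology.FourManifolds.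
/-- item stmt-SmoothPoincare4-11359 · support · rank 9 · open · by planner
sources: KervaireMilnor1963, Kosinski1993, BudneyGabai2019
[support] (sibling card, platform) for every Hausdorff, second countable, compact smooth 4-manifold
M ≃ₕ S⁴ there is a closed smooth 4-manifold P which is a connected sum M # (S¹×S³) (tree
ConnectedSumExistence), is homotopy equivalent to S¹×S³ (M° is a homotopy 4-ball glued to (S¹×S³)°),
and contains a smooth non-separating S³ (a fibre {θ}×S³ missing the summing ball). RESTATED
2026-08-15 rev 5 (route-repair, cone) over a plain `M ≃ₕ S⁴` (was `S : HomotopySphere 4`; equivalent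
modulo the proved orientability theorem, Bridge.lean rc 0) so that the route file no longer imports
HomotopySpheres.lean. [difficulty: L] Sources: KervaireMilnor1963, Kosinski1993, BudneyGabai2019. -/
@[route_item "route-SmoothPoincare4-CircularKirby", crux]
def Platform : Prop :=
  ∀ (M : Type) [TopologicalSpace M] [T2Space M] [SecondCountableTopology M] [CompactSpace M] [ChartedSpace (EuclideanSpace ℝ (Fin 4)) M] [IsManifold (𝓡 4) ∞ M], M ≃ₕ (Metric.sphere (0 : EuclideanSpace ℝ (Fin 5)) 1) → ∃ (P : Type) (_ : TopologicalSpace P) (_ : T2Space P) (_ : SecondCountableTopology P) (_ : CompactSpace P) (_ : ChartedSpace (EuclideanSpace ℝ (Fin 4)) P) (_ : IsManifold (𝓡 4) ∞ P), Literature.Topology.FourManifolds.IsConnectedSum (𝓡 4) (𝓡 4) ((𝓡 1).prod (𝓡 3)) M (Circle × (Metric.sphere (0 : EuclideanSpace ℝ (Fin 4)) 1)) P ∧ Nonempty (P ≃ₕ (Circle × (Metric.sphere (0 : EuclideanSpace ℝ (Fin 4)) 1))) ∧ ∃ e : (Metric.sphere (0 : EuclideanSpace ℝ (Fin 4)) 1)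 → P, Manifold.IsSmoothEmbedding (𝓡 3) (𝓡 4) ∞ e ∧ IsConnected (Set.range e)ᶜ

/-- item stmt-SmoothPoincare4-6426 · support · rank 9 · open · by planner
sources: BudneyGabai2019, arXiv:1912.09029
[support] KNOWN THEOREM (Budney–Gabai 2019, Thm 3.13, n = 3; cite item filed — grounder: promote to
a Literature named fact, provers do not formalise from scratch): Diff(S¹×S³) acts transitively on
smoothly embedded non-separating 3-spheres, i.e. every smooth embedding e : S³ → S¹×S³ with
connected complement of its image is carried by a self-diffeomorphism onto {1}×S³. It is the
hypothesis of Remembers and of the Assembly. [difficulty: XL] -/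
@[route_item "route-SmoothPoincare4-CircularKirby", crux]
def NonSepSphereTransitive : Prop :=
  ∀ e : (Metric.sphere (0 : EuclideanSpace ℝ (Fin 4)) 1) → Circle × (Metric.sphere (0 : EuclideanSpace ℝ (Fin 4)) 1), Manifold.IsSmoothEmbedding (𝓡 3) ((𝓡 1).prod (𝓡 3)) ∞ e → IsConnected (Set.range e)ᶜ → ∃ Φ : (Circle × (Metric.sphere (0 : EuclideanSpace ℝ (Fin 4)) 1)) ≃ₘ⟮(𝓡 1).prod (𝓡 3), (𝓡 1).prod (𝓡 3)⟯ (Circle × (Metric.sphere (0 : EuclideanSpace ℝ (Fin 4)) 1)), Φ '' (Set.range e) = Set.range (fun p : (Metric.sphere (0 : EuclideanSpace ℝ (Fin 4)) 1) => ((1 : Circle), p))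

-- earlier Assembly (stmt-SmoothPoincare4-6430, replaced 2026-08-15T16:40:32Z -> stmt-SmoothPoincare4-11058): retired by None — Literature.Topology.FourManifolds.nonempty_diffeomorph_sphere_three.{0} → Literature.Topology.FourManifolds.cerf_pi0Diff_sphere_three → NonSepSphereTransitive → RankTwo → WidthFour → FibredIsStandard → Remembers → Platform → SmoothPoincare4
/-- item stmt-SmoothPoincare4-11117 · assembly · rank 1 · open · by planner
sources: BudneyGabai2019, Perelman2002, CerfDiffeoSphere1968, KervaireMilnor1963, MorganTian2007
[assembly] PoincareThreeSphere → CerfDiffSphereThree → NonSepSphereTransitive → RankTwo → WidthFour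
→ FibredIsStandard → Remembers → Platform → SmoothPoincare4 (restated 2026-08-15 over the route's
own item names; the deciding theorem `closes` is the proof that the items decide the Statement). -/
@[route_item "route-SmoothPoincare4-CircularKirby", crux]
def Assembly : Prop :=
  PoincareThreeSphere → CerfDiffSphereThree → NonSepSphereTransitive → RankTwo → WidthFour → FibredIsStandard → Remembers → Platform → SmoothPoincare4

/-! D-0027 §2.1 — DECIDING THEOREM (planner-authored via `route open/edit --closes-file`; by planner-rrepair-SmoothPoincare4-CircularKirby-973ca3bb-g2-0 2026-08-15T17:25:54Z):
its hypotheses are this route's items and its conclusion the sub-problem Statement (glue_lint), and it elaborates with this file. -/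

@[closes "route-SmoothPoincare4-CircularKirby"] theorem closes (_hT : Target) (hR2 : RankTwo) (_hR1 : RankOne) (hW4 : WidthFour)
    (hP3 : PoincareThreeSphere) (hNS : NonSepSphereTransitive) (hFS : FibredIsStandard) (hP : Platform)
    (hRem : Remembers) (hCerf : CerfDiffSphereThree) (_hA : Assembly) :
    _root_.SmoothPoincare4 := by
  -- The Statement quantifies over every Hausdorff second-countable smooth 4-manifold `M ≃ₕ S⁴`;
  -- compactness is a PROVED tree theorem (`compactSpace_of_homotopyEquiv_sphere_four_holds`,
  -- HomotopyS4CompactProofs), used inside the proof, not assumed. Then: Platform gives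
  -- `P = M # (S¹×S³)` with `P ≃ₕ S¹×S³` and a non-separating `S³`; WidthFour gives a primitive
  -- circle-valued Morse function with ≤ 4 critical points; RankTwo makes it a primitive submersion;
  -- FibredIsStandard (fed the route's own recogniser items PoincareThreeSphere and
  -- CerfDiffSphereThree) gives `P ≅ S¹×S³`; Remembers (fed CerfDiffSphereThree and
  -- NonSepSphereTransitive) gives `M ≅ S⁴`.
  intro M _ _ _ _ _ e
  haveI : CompactSpace M :=
    Literature.Topology.FourManifolds.compactSpace_of_homotopyEquiv_sphere_four_holds M e
  obtain ⟨P, _, _, _, _, _, _, hcs, ⟨eP⟩, hemb⟩ := hP M e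
  exact hRem hCerf hNS M e P hcs (hFS hP3 hCerf P eP (hR2 P eP hemb (hW4 P eP hemb)))

end Summit.SmoothPoincare4.SmoothPoincare4.Theses.CircularKirby
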